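import Literature.IUT.HodgeArakelov.ThetaEvaluationSettingProofs2

/-!
# [IUTchII] Prop 2.2 (i)′ — the stabilising representative of `ι` CONSTRUCTED (third proof-only companion)

Proof-only companion (abc-iut cell, D-0067 wave 4, cone of [IUTchIII] Cor. 3.12; node **IUTchII:Prop2.2(i)**; no
definitions). S. Mochizuki, *Inter-universal Teichmüller theory II*, kurims manuscript (Dec. 2020) §2, Prop. 2.2
p. 66 (claim key `Mochizuki2012`, DISPUTED, D-0012). Nothing here takes a side on [IUTchIII] Cor. 3.12.

`ThetaEvaluationSettingProofs2.lean` proved the existence clause of the repaired `Prop22_i'` modulo the printed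
normalisation "we may assume that `Π_{v•}`, `Π_{v▶}`, and `ι := ι_Ÿ` … have been chosen so that some representative
of `ι` stabilizes `Π_{v•}` and `Π_{v▶}`" (p. 66 l. 44–47), taken verbatim as the hypothesis `hstab`
(plan/GAP-LEDGER.md row G-w4d010-1). HERE that normalisation is DERIVED — `prop22_i'_of_groupTheoretic` — from
three inputs of the printed proof, each a statement about the INPUT data in interface-level shape:

* the landed anabelian input `SubgraphReference.GroupTheoretic` ("dual graphs of stable models may be
  reconstructed … from the corresponding tempered fundamental group", p. 67; [SemiAnbd] Cor. 3.11 / [AbsTopI]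
  Thm. 2.14 (i)): applied to the automorphism `e ∘ ι₀ ∘ e⁻¹` it says that the pointed inversion `ι₀` (Rmk. 1.4.1
  (ii)) carries the pair `(Π_{v▶}, Π_{v•})` onto a COMMON `Π_v`-conjugate `k·(Π_{v▶}, Π_{v•})·k⁻¹`
  (`SubgraphReference.GroupTheoretic.exists_conj_of_aut`);
* `Π_{v•}·Δ = Π_v` (hypothesis `hsurj`): the decomposition group of the vertex labelled `0` — a component of the
  special fibre defined over the residue field — surjects onto the Galois group, i.e. every element of `Π_v` is
  congruent modulo `Δ = Ker(Π_v ≅ Π_X(M^Θ(Π_v)) ↠ G)` (the `Δ` of `PointedInversion`) to an element of `Π_{v•}`;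
  assumed for ONE identification with the reference, it transfers to all of them by `GroupTheoretic`
  (`SubgraphReference.GroupTheoretic.exists_mem_bullet`). It supplies `b ∈ Π_{v•}` with `b ≡ k (mod Δ)`, and
  `δ := b·k⁻¹ ∈ Δ` conjugates `ι₀` into a representative stabilising BOTH groups (`b` normalises
  `Π_{v•} ⊆ Π_{v▶}`);
* `Π_Ÿ(Π_v) ⊴ Π_v` (hypothesis `hN`; the covering `Ÿ̲̲_v → X̲̲_v` is Galois with group `(l·ℤ) × μ_2`, [EtTh] §2,
  Rmk. 2.1.1 (i); at the model it is abc-iut-L6-t1's `EtaleThetaDataOfSetting.piYdd_normal`): with the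
  `PointedInversion` field `iotaYdd_lifts` (`ι_Ÿ` is a `Δ`-conjugate of `ι₀` on `Π_Ÿ`) every `Δ`-conjugate of
  `ι₀` maps `Π_Ÿ(Π_v)` onto itself.

So the repaired `Prop22_i' R T D ι₀` HOLDS given `R.GroupTheoretic`, `D.PiYdd.Normal` and `hsurj`; the residual
inputs are anabelian/geometric statements about the reference data, recorded on plan/GAP-LEDGER.md (disposition
row of G-w4d010-1). typed ≠ proved for those inputs.
-/

namespace Literature.IUT.HodgeArakelov

universe u

variable {S : BadPlaceSetting.{u}} {P : TopGroup.{u}} {E : EnvOfGroup S.toThetaSetting P}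

/-- Membership in the image of a subgroup under a continuous multiplicative equivalence. [folklore] -/
private theorem mem_map_cme₃ {G' H' : TopGroup.{u}} {K : Subgroup G'} (e : G' ≃ₜ* H') {y : H'} :
    y ∈ K.map e.toMulEquiv.toMonoidHom ↔ e.symm y ∈ K :=
  Subgroup.mem_map_equiv

/-- Membership in the image of a subgroup under a conjugation automorphism. [folklore] -/
private theorem mem_map_conj₃ {G : Type u} [Group G] {K : Subgroup G} {g x : G} :
    x ∈ K.map (MulAut.conj g).toMonoidHom ↔ g⁻¹ * x * g ∈ K := by
  rw [Subgroup.mem_map_equiv, MulAut.conj_symm_apply]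

/-- The pointwise content of an equality `K.map (e ∘ α ∘ e⁻¹) = K.map (conj g)` of subgroups of the reference
group, read in `P` along `e`: `α` carries `e⁻¹K` INTO `k·e⁻¹K·k⁻¹` (`k = e⁻¹ g`), and ONTO it. [folklore] -/
private theorem into_onto_of_map_eq (K : Subgroup S.PiX) (e : P ≃ₜ* S.PiX) (α : P ≃ₜ* P) (g : S.PiX)
    (hK : K.map ((e.symm.trans α).trans e).toMulEquiv.toMonoidHom = K.map (MulAut.conj g).toMonoidHom) :
    (∀ x : P, e x ∈ K → e ((e.symm g)⁻¹ * α x * e.symm g) ∈ K) ∧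
      ∀ x : P, e x ∈ K → ∃ y : P, e y ∈ K ∧ α y = e.symm g * x * (e.symm g)⁻¹ := by
  constructor
  · intro x hx
    have h1 : e (α x) ∈ K.map ((e.symm.trans α).trans e).toMulEquiv.toMonoidHom := by
      rw [mem_map_cme₃, ContinuousMulEquiv.symm_trans_apply, ContinuousMulEquiv.symm_trans_apply,
        ContinuousMulEquiv.symm_symm, ContinuousMulEquiv.symm_apply_apply,
        ContinuousMulEquiv.symm_apply_apply]
      exact hx
    rw [hK, mem_map_conj₃] at h1
    rw [map_mul, map_mul, map_inv, ContinuousMulEquiv.apply_symm_apply]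
    exact h1
  · intro x hx
    have hz : g * e x * g⁻¹ ∈ K.map (MulAut.conj g).toMonoidHom := by
      rw [mem_map_conj₃, show g⁻¹ * (g * e x * g⁻¹) * g = e x by group]
      exact hx
    rw [← hK, mem_map_cme₃, ContinuousMulEquiv.symm_trans_apply, ContinuousMulEquiv.symm_trans_apply,
      ContinuousMulEquiv.symm_symm] at hz
    refine ⟨α.symm (e.symm (g * e x * g⁻¹)), hz, ?_⟩
    rw [ContinuousMulEquiv.apply_symm_apply, map_mul, map_mul, map_inv, ContinuousMulEquiv.symm_apply_apply]

/-- Reading `SubgraphReference.GroupTheoretic` pointwise along an identification `e : Π_v ≅ Π^tp_{X̲̲_v}`: ANY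
automorphism `α` of the topological group `Π_v` carries the pulled-back pair `(e⁻¹Π^tp_{X,Γ▶}, e⁻¹Π^tp_{X,Γ•})`
INTO and ONTO a COMMON `Π_v`-conjugate `k·(−)·k⁻¹` ([IUTchII] Prop. 2.2 (i), proof p. 67: "dual graphs of stable
models may be reconstructed … from the corresponding tempered fundamental group").
[claim: Mochizuki2012, status: disputed] (IUTchII §2 Prop 2.2 (i), kurims pp.66-67) -/
theorem SubgraphReference.GroupTheoretic.exists_conj_of_aut {R : SubgraphReference S} (hG : R.GroupTheoretic)
    (e : P ≃ₜ* S.PiX) (α : P ≃ₜ* P) :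
    ∃ k : P, (∀ x : P, e x ∈ R.refTri → e (k⁻¹ * α x * k) ∈ R.refTri) ∧
      (∀ x : P, e x ∈ R.refTri → ∃ y : P, e y ∈ R.refTri ∧ α y = k * x * k⁻¹) ∧
      (∀ x : P, e x ∈ R.refBullet → e (k⁻¹ * α x * k) ∈ R.refBullet) ∧
      (∀ x : P, e x ∈ R.refBullet → ∃ y : P, e y ∈ R.refBullet ∧ α y = k * x * k⁻¹) := by
  obtain ⟨g, htri, hbul⟩ := hG ((e.symm.trans α).trans e)
  obtain ⟨h₁, h₂⟩ := into_onto_of_map_eq R.refTri e α g htri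
  obtain ⟨h₃, h₄⟩ := into_onto_of_map_eq R.refBullet e α g hbul
  exact ⟨e.symm g, h₁, h₂, h₃, h₄⟩

/-- TRANSFER of "`Π_{v•}` surjects onto the Galois group" between identifications with the reference: if, along
ONE identification `e₀ : Π_v ≅ Π^tp_{X̲̲_v}`, every element of `Π_v` is congruent modulo
`Δ = Ker(Π_v ≅ Π_X(M^Θ(Π_v)) ↠ G)` to an element of `e₀⁻¹Π^tp_{X,Γ•}`, then the same holds along EVERY
identification `e` — by `GroupTheoretic`, `e⁻¹Π^tp_{X,Γ•}` is a `Π_v`-conjugate of `e₀⁻¹Π^tp_{X,Γ•}`, and `Δ` is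
normal. [claim: Mochizuki2012, status: disputed] (IUTchII §2 Prop 2.2 (i), kurims pp.66-67) -/
theorem SubgraphReference.GroupTheoretic.exists_mem_bullet {R : SubgraphReference S} (hG : R.GroupTheoretic)
    (hsurj : ∃ e₀ : P ≃ₜ* S.PiX, ∀ x : P, ∃ b : P, e₀ b ∈ R.refBullet ∧
      E.recon.projG (E.isoX b) = E.recon.projG (E.isoX x))
    (e : P ≃ₜ* S.PiX) (x : P) :
    ∃ b : P, e b ∈ R.refBullet ∧ E.recon.projG (E.isoX b) = E.recon.projG (E.isoX x) := by
  obtain ⟨e₀, h⟩ := hsurj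
  -- `β := e₀⁻¹ ∘ e ∈ Aut(Π_v)`: `e y ∈ Π^tp_{X,Γ•} ↔ e₀ (β y) ∈ Π^tp_{X,Γ•}`
  let β : P ≃ₜ* P := e.trans e₀.symm
  have he : ∀ y : P, e y = e₀ (β y) := fun y => by
    change e y = e₀ (e₀.symm (e y))
    rw [ContinuousMulEquiv.apply_symm_apply]
  obtain ⟨k, -, -, hinto, -⟩ := hG.exists_conj_of_aut e₀ β
  -- `m := β⁻¹(k⁻¹)`; then `e⁻¹Π^tp_{X,Γ•} ⊇ m·(e₀⁻¹Π^tp_{X,Γ•})·m⁻¹`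
  obtain ⟨m, hm⟩ : ∃ m : P, β m = k⁻¹ := ⟨β.symm k⁻¹, ContinuousMulEquiv.apply_symm_apply β k⁻¹⟩
  obtain ⟨b₀, hb₀, hπ⟩ := h (m⁻¹ * x * m)
  refine ⟨m * b₀ * m⁻¹, ?_, ?_⟩
  · rw [he, map_mul β, map_mul β, map_inv β, hm, inv_inv]
    exact hinto b₀ hb₀
  · simp only [map_mul, map_inv] at hπ ⊢
    rw [hπ]
    group

/-- **IUTchII:Prop2.2(i)′ HOLDS given three inputs about the reference data** (kurims p. 66; the printed
normalisation "we may assume that `Π_{v•}`, `Π_{v▶}`, and `ι := ι_Ÿ` … have been chosen so that some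
representative of `ι` stabilizes `Π_{v•}` and `Π_{v▶}`" is now DERIVED, not assumed): (1) the landed anabelian
input `R.GroupTheoretic` ([SemiAnbd] Cor. 3.11 / [AbsTopI] Thm. 2.14 (i), proof p. 67); (2) `hN`: `Π_Ÿ(Π_v)` is
normal in `Π_v` (`Ÿ̲̲_v → X̲̲_v` Galois, [EtTh] §2 / Rmk. 2.1.1 (i)); (3) `hsurj`: along one identification with the
reference, `Π_{v•}·Δ = Π_v` (the decomposition group of the vertex `0` surjects onto the Galois group). PROOF:
`GroupTheoretic` gives `ι₀(Π_{v▶}, Π_{v•}) = k(Π_{v▶}, Π_{v•})k⁻¹` simultaneously; choose `b ∈ Π_{v•}` with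
`b ≡ k (mod Δ)`; the `Δ`-conjugate `x ↦ (bk⁻¹)·ι₀(x)·(bk⁻¹)⁻¹` maps `Π_{v▶}`, `Π_{v•}` (as `b` normalises both) and
`Π_Ÿ(Π_v)` (normality + `iotaYdd_lifts`) onto themselves — this is the hypothesis `hstab` of
`prop22_i'_of_stableRepresentative`. [claim: Mochizuki2012, status: disputed]
(IUTchII §2 Prop 2.2 (i), kurims pp.66-67) -/
theorem prop22_i'_of_groupTheoretic (R : SubgraphReference S) (T : TemperedCoverings S P)
    (D : EtaleThetaData S.toThetaSetting P) (ι₀ : PointedInversion E D) (hG : R.GroupTheoretic)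
    (hN : D.PiYdd.Normal)
    (hsurj : ∃ e₀ : P ≃ₜ* S.PiX, ∀ x : P, ∃ b : P, e₀ b ∈ R.refBullet ∧
      E.recon.projG (E.isoX b) = E.recon.projG (E.isoX x)) :
    Prop22_i' R T D ι₀ := by
  refine prop22_i'_of_stableRepresentative R T D ι₀ hG fun e _ => ?_
  obtain ⟨k, htri, htri', hbul, hbul'⟩ := hG.exists_conj_of_aut e ι₀.iota
  obtain ⟨b, hb, hπb⟩ := hG.exists_mem_bullet hsurj e k
  have hbT : e b ∈ R.refTri := R.refBullet_le hb
  obtain ⟨δ₂, -, hlift⟩ := ι₀.iotaYdd_lifts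
  -- `ι₀` maps `Π_Ÿ(Π_v)` into itself (it is `Δ`-conjugate to the automorphism `ι_Ÿ` of the NORMAL subgroup)
  have hιYdd : ∀ x : P, x ∈ D.PiYdd → ι₀.iota x ∈ D.PiYdd := by
    intro x hx
    have h1 := hlift ⟨x, hx⟩
    have h2 : ι₀.iota x = δ₂⁻¹ * ((ι₀.iotaYdd ⟨x, hx⟩ : D.PiYdd) : P) * δ₂ := by rw [h1]; group
    rw [h2]
    exact hN.conj_mem' _ (ι₀.iotaYdd ⟨x, hx⟩).2 δ₂
  refine ⟨b * k⁻¹, ?_, ?_, ?_, ?_, ?_, ?_, ?_⟩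
  · -- `δ := b·k⁻¹ ∈ Δ`
    simp only [map_mul, map_inv, hπb, mul_inv_cancel]
  · -- `Π_{v▶}` into itself
    intro x hx
    have h1 := htri x hx
    rw [show b * k⁻¹ * ι₀.iota x * (b * k⁻¹)⁻¹ = b * (k⁻¹ * ι₀.iota x * k) * b⁻¹ by group, map_mul, map_mul,
      map_inv]
    exact R.refTri.mul_mem (R.refTri.mul_mem hbT h1) (R.refTri.inv_mem hbT)
  · -- `Π_{v▶}` onto itself
    intro x hx
    obtain ⟨y, hy, hιy⟩ := htri' (b⁻¹ * x * b) (by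
      rw [map_mul, map_mul, map_inv]
      exact R.refTri.mul_mem (R.refTri.mul_mem (R.refTri.inv_mem hbT) hx) hbT)
    exact ⟨y, hy, by rw [hιy]; group⟩
  · -- `Π_{v•}` into itself
    intro x hx
    have h1 := hbul x hx
    rw [show b * k⁻¹ * ι₀.iota x * (b * k⁻¹)⁻¹ = b * (k⁻¹ * ι₀.iota x * k) * b⁻¹ by group, map_mul, map_mul,
      map_inv]
    exact R.refBullet.mul_mem (R.refBullet.mul_mem hb h1) (R.refBullet.inv_mem hb)
  · -- `Π_{v•}` onto itself
    intro x hx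
    obtain ⟨y, hy, hιy⟩ := hbul' (b⁻¹ * x * b) (by
      rw [map_mul, map_mul, map_inv]
      exact R.refBullet.mul_mem (R.refBullet.mul_mem (R.refBullet.inv_mem hb) hx) hb)
    exact ⟨y, hy, by rw [hιy]; group⟩
  · -- `Π_Ÿ(Π_v)` into itself
    intro x hx
    exact hN.conj_mem _ (hιYdd x hx) (b * k⁻¹)
  · -- `Π_Ÿ(Π_v)` onto itself
    intro x hx
    have hx' : (b * k⁻¹)⁻¹ * x * (b * k⁻¹) ∈ D.PiYdd := hN.conj_mem' x hx (b * k⁻¹)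
    have hw : δ₂ * ((b * k⁻¹)⁻¹ * x * (b * k⁻¹)) * δ₂⁻¹ ∈ D.PiYdd := hN.conj_mem _ hx' δ₂
    obtain ⟨y₀, hy₀⟩ := ι₀.iotaYdd.surjective ⟨_, hw⟩
    refine ⟨(y₀ : P), y₀.2, ?_⟩
    have h1 := hlift y₀
    rw [hy₀] at h1
    change δ₂ * ((b * k⁻¹)⁻¹ * x * (b * k⁻¹)) * δ₂⁻¹ = δ₂ * ι₀.iota (y₀ : P) * δ₂⁻¹ at h1
    have h2 : ι₀.iota (y₀ : P) = (b * k⁻¹)⁻¹ * x * (b * k⁻¹) :=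
      (mul_left_cancel (mul_right_cancel h1)).symm
    rw [h2]
    group

end Literature.IUT.HodgeArakelov
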